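import Literature.AlgebraicGeometry.ComplexMultiplication.CyclotomicFermatCMTypesTheoremTwoEveryLevel
import Literature.AlgebraicGeometry.ComplexMultiplication.CyclotomicCMTypeIsogenyClasses
import HarnessLib

/-!
# Koblitz–Rohrlich p. 1184 with THEOREM 2 at every level `N` prime to `6`, ON ABELIAN VARIETIES: the stabiliser `W_{1,a,−1−a}` as an
# explicit set, the NUMBER `|W| ∈ {1, 2, 3}` of simple factors, `A ∼ B³` for the family `{1, w, w²}` and `A ∼ B²` for `{1, w, −1−w}`

Layer `Literature/AlgebraicGeometry/ComplexMultiplication`, namespace `…ComplexMultiplication.CyclotomicFermatCMType`; sequel of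
`CyclotomicFermatCMTypesTheoremTwoEveryLevel` (this lane gen 40: the stabiliser TABLE `fermatCMType_mul_eq_iff_coprimeSix` —
`H_{w,wa,w(−1−a)} = H_{1,a,−1−a}` iff `w = 1` or one of the two printed families — and `W = {1}` for primitive triples without a unit
entry, whose honest column reads «the count `|W|` as an isogeny decomposition "into `|W|` isomorphic simple factors" is not typed») and of
`CyclotomicCMTypeIsogenyClasses` (gen 14: `exists_isIsogeny_power_simple_cyclotomic` — every abelian variety of type `(ℚ(ζ_N); Φ)` is
`𝓞_{K₁}`-equivariantly isogenous to `B^{|W|}`, `B` SIMPLE of the primitive sub-type `(K₁; Φ₁)`, `[ℚ(ζ_N) : K₁] = |W|`, `2 dim B · |W| =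
φ(N)` —, and AT PRIME LEVEL `W_{1,a} = {1, a, a²}`, `A_{S_a} ∼ B × B × B` for `a³ ≡ 1 ≢ a`).  THIS FILE joins the two at EVERY level
prime to `6`.  THEOREMS ONLY (no definition, no named fact, no `sorry`; kernel checks `decide` only for the numerical facts
`6² ≡ 1 (35)`, `1 + 9 + 81 ≡ 0`, `27² ≡ 1 (91)`, `φ(35) = 24`, `φ(91) = 72` in the non-vacuity statements).

THE SOURCE.  N. Koblitz, D. Rohrlich, *Simple factors in the Jacobian of a Fermat curve*, Canad. J. Math. **30** (1978) 1183–1205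
(held `paper:koblitz1978-simple-factors-jacobian-fermat-curve`, pp. 1184–1186 read first-hand).  P. 1184: "To determine when `L_{r,s}`
is simple, we use a criterion of Shimura–Taniyama [7]: Let `W_{r,s} = {w ∈ (ℤ/Mℤ)* : wH_{r,s} = H_{r,s}}`.  Then `W_{r,s}` is a subgroup
of `(ℤ/Mℤ)*`, and `L_{r,s}` is simple if and only if `W_{r,s} = {1}`.  Suppose `W_{r,s} ≠ {1}`.  Then `L_{r,s}` is isogenous to a
product of `|W_{r,s}|` isomorphic simple factors, where `|W_{r,s}|` is the cardinality of `W_{r,s}`.  These factors have complex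
multiplication by an order of the fixed field of `W_{r,s}` and CM-type equal to `H_{r,s}/W_{r,s}` (viewed as a subset of the Galois
group of the fixed field of `W_{r,s}` over `ℚ`)."  Pp. 1185–1186: "If at least one of `rM/N, sM/N, tM/N` is prime to `M` … then one
deduces that for `w ≠ 1`, either `1 + w + w² = 0` in `ℤ/Mℤ` or `w² = 1` in `ℤ/Mℤ`.  It follows that after multiplying by an element
of `(ℤ/Nℤ)*`, we have `{r, s, t} = {N/M, ⟨wN/M⟩, ⟨w²N/M⟩}` or `{r, s, t} = {N/M, ⟨wN/M⟩, ⟨−(1+w)N/M⟩}` respectively.  On the other hand,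
suppose `rM/N, sM/N, tM/N` each have a common factor with `M`.  Then necessarily … `w ≡ 1 mod M`.  Hence `L_{r,s,t}` is simple.  To
summarize: THEOREM 2.  Suppose `N` is prime to `6`.  The only lattices `L_{r,s,t}` which are not simple are those for which `{r, s, t}`
is equivalent to a triple of the form `{N/M, ⟨wN/M⟩, ⟨w²N/M⟩}`, for some divisor `M` of `N`, and some `w ∈ ℤ/Mℤ` such that `1 + w + w² =
0`, or to a triple of the form `{N/M, ⟨wN/M⟩, ⟨−(1+w)N/M⟩}`, for some divisor `M` of `N`, and some `w ∈ ℤ/Mℤ` such that `w² = 1`,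
`w ≠ ±1`."

READING (as in the siblings).  Level `M = N` (primitive triples); K–R's `W_τ` is the residue stabiliser
`{t ∈ (ℤ/N)ˣ | ∀ c ∈ (ℤ/N)ˣ, ct ∈ H_τ ⟺ c ∈ H_τ}` (a `Finset.filter` of `unitResidues N`, no new definition — the same expression as in
`CyclotomicCMTypeIsogenyClasses` §§4–5); a triple with a unit entry is normalised to `(1, a, −1−a)` (NO unit hypothesis on `a`, `1 + a`);
the two printed families are `a = w` with `1 + w + w² = 0` (then `−1−a = w²`: the triple `{1, w, w²}`) and `a = w` with `w² = 1`,
`w ≠ ±1` (the triple `{1, w, −1−w}`; in the normal form through `1` the same family also appears as `(1+a)² = 1`, `a ∉ {0, −2}`, i.e.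
`−1−a` is the involution); "simple" ∕ "isogenous to a product" are statements about abelian varieties `(A, ι, θ)` REALISING the CM type
`Φ_{H_τ}` of `ℚ(ζ_N)` (`IsCMTypeRealisation`), the product being a limit fan `B^{|W|}` and the isogeny `𝓞_{K₁}`-equivariant, exactly as
in `exists_isIsogeny_power_simple_cyclotomic`.

## What is proved (every `N` prime to `6`; `H = H_{1,a,−1−a}`, `a, −1−a ≠ 0`)

* §1 **`mem_stabilizerResidues_fermat_one_iff_coprimeSix`** — `t ∈ W_{1,a,−1−a}` iff `t = 1`, or `1 + a + a² = 0 ∧ a ≠ 1 ∧ t ∈ {a, a²}`,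
  or `a² = 1 ∧ a ≠ ±1 ∧ t = a`, or `(1+a)² = 1 ∧ a ∉ {0,−2} ∧ t = −1−a` (the stabiliser table read as a membership criterion); the
  four EXPLICIT STABILISERS **`stabilizerResidues_fermat_one_eq_triple_coprimeSix`** (`W = {1, a, a²}`, first family),
  **`stabilizerResidues_fermat_one_eq_pair_coprimeSix`** (`W = {1, a}`, second family), **`stabilizerResidues_fermat_one_eq_pair'_coprimeSix`**
  (`W = {1, −1−a}`, second family through the other unit entry), **`stabilizerResidues_fermat_one_eq_singleton_coprimeSix`** (`W = {1}`
  otherwise), with cardinalities `3`, `2`, `2`, `1` (`card_stabilizerResidues_fermat_one_eq_three_coprimeSix`, `…_eq_two_…`, `…_eq_two'_…`,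
  `…_eq_one_…`) and **`card_stabilizerResidues_fermat_one_le_three_coprimeSix`** (`|W_{1,a,−1−a}| ≤ 3` always).
* §2 unit scaling and the no-unit case: `stabilizerResidues_fermatCMType_mul_eq` (`W_{uτ} = W_τ` for a unit `u`, any `N`),
  **`card_stabilizerResidues_fermatCMType_le_three_coprimeSix`** — for EVERY admissible primitive triple `τ` at a level prime to `6`,
  `|W_τ| ≤ 3` (a unit entry: normalise and §1; no unit entry: `W_τ = {1}` by the sibling's `hasTrivialStabilizer_of_not_isUnit`).
* §3 ON ABELIAN VARIETIES (`L = ℚ(ζ_N)` any model; `N` prime to `6` forces `N ≥ 5`, so `L` is a CM field):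
  **`exists_isIsogeny_cube_simple_of_fermat_one_coprimeSix`** — FIRST FAMILY `{1, w, w²}` (`1 + w + w² = 0`, `w ≠ 1`): every abelian variety
  of type `Φ_{H_{1,w,w²}}` is `𝓞_{K₁}`-equivariantly isogenous to `B × B × B`, `B` SIMPLE, `6 dim B = φ(N)`, `K₁ ⊂ ℚ(ζ_N)` the CM subfield
  of index `3` carrying the primitive sub-type `Φ₁` («fixed field of `W`», «CM-type `H/W`»), superseding the prime-level
  `exists_isIsogeny_cube_simple_of_fermat`; **`exists_isIsogeny_square_simple_of_fermat_one_coprimeSix`** — SECOND FAMILY `{1, w, −1−w}`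
  (`w² = 1`, `w ≠ ±1`; absent at prime-power level): every abelian variety of type `Φ_{H_{1,w,−1−w}}` is isogenous to `B × B`, `B`
  SIMPLE, `4 dim B = φ(N)`, `K₁` of index `2` (and `…_of_sq'` for the same family through the non-unit position, `(1+a)² = 1`);
  short forms `…'` (`B` simple of CM type, `IsOfCMType`); THE COUNT for every admissible PRIMITIVE triple:
  **`exists_isIsogeny_power_simple_le_three_coprimeSix`** (`A ∼ B^h` `𝓞_{K₁}`-equivariantly, `B` simple, `[ℚ(ζ_N) : K₁] = h`,
  `2h·dim B = φ(N)`, `1 ≤ h ≤ 3` — "a product of `|W|` isomorphic simple factors", at most three).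
* §4 NON-VACUITY: `N = 35`, `w = 6` (`6² ≡ 1`, `6 ≢ ±1`): realisations of `Φ_{H_{1,6,28}}` exist (dimension `12`) and each is
  isogenous to `B × B` with `B` a SIMPLE abelian sixfold (`exists_realisation_isIsogeny_square_thirtyFive`); `N = 91 = 7·13` carries
  BOTH families (`w = 9`: `1 + 9 + 81 ≡ 0`; `w = 27`: `27² ≡ 1`): `A_{1,9,81} ∼ B³` with `dim B = 12`, `A_{1,27,63} ∼ B²` with
  `dim B = 18` (`exists_realisation_isIsogeny_cube_ninetyOne`, `exists_realisation_isIsogeny_square_ninetyOne`).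

## Honest column / NOT here

* As in the siblings, "isogenous to `B^h`" is an isogeny `A → P` onto a limit fan `P = B^h` over `Fin h`, `B` SOME realisation of the
  primitive sub-pair `(K₁; Φ₁)` (any two are isogenous); "isomorphic simple factors" is rendered as "`h` copies of one simple `B`";
  K–R's lattices `L_{r,s,t}` and the Jacobian are not constructed.  `K₁` is obtained from the tree's primitive sub-pair
  (`exists_isIsogeny_power_simple_cyclotomic`), characterised by `[ℚ(ζ_N) : K₁] = |W|` and `Φ = Φ₁^{ℚ(ζ_N)}`; its identification with the
  fixed field of the Galois elements `σ_t`, `t ∈ W`, is the sibling's `eq_fixedField_stabilizer_of_primitive` and is not restated.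
* Level `M = N` only (lower levels are the same statements at level `M`, cf. `CyclotomicFermatCMTypesLevelOnVarieties`); for a triple
  with a unit entry `r` the statements are given in the normal form `(1, a, −1−a)` (`a = s/r`), the transport `H_{r,s,t} = H_{r·(1,a,−1−a)}`
  being the siblings' `mem_fermatCMType_mul_iff_of_isUnit` ∕ §2 here.
* Theorem 2's last sentence (prime level `p ≡ 1, 2 mod 3`) and the prime-level cube are the siblings' (`…PrimeLevelSimple`,
  `CyclotomicCMTypeIsogenyClasses`); nothing is restated from them.

## References

* [KoblitzRohrlich1978] N. Koblitz, D. Rohrlich, Canad. J. Math. 30 (1978) 1183–1205: §1 p. 1184 (`W_{r,s}`, `|W_{r,s}|` simple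
  factors, fixed field, type `H/W`), Theorem 2 and its proof (pp. 1185–1186).
* [Shimura1998] G. Shimura, *Abelian Varieties with Complex Multiplication and Modular Functions* (1998), §8.2 Prop. 26, §6.2
  Theorem 3, §6.1 Corollary (through `CyclotomicCMTypeIsogenyClasses`, `SimpleIffPrimitiveCMType`).
* [MilneCM2006] J. S. Milne, *Complex Multiplication* (course notes), Ch. I §3, proof of Prop. 3.13 (through
  `SimpleCMAbelianVarietyIsogenyClasses`).

## Provenance

Cell `pub-hodgecm2` (COR-CM), literature seat `lit-deligne-3` gen 41 (claim KR78-THM2-FACTORS; count-neutral, own lane).  HC_CM is NOT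
proved and nothing here bears on it.
-/

noncomputable section

open NumberField

namespace Literature.AlgebraicGeometry.ComplexMultiplication

open CategoryTheory CategoryTheory.Limits
open Literature.AlgebraicGeometry.Motives (CMType AbelianVariety)
open Literature.AlgebraicGeometry.Motives.AbelianVariety
open Literature.NumberTheory.ComplexMultiplication
open Literature.AlgebraicGeometry.HodgeTheory
open Literature.AlgebraicGeometry.Pohlmann1968 Literature.AlgebraicGeometry.Pohlmann1968.Cyclotomic
open CyclotomicCMTypeResidueSets (IsCMResidueSet HasTrivialStabilizer unitResidues residueSet residueSet_cmTypeOfResidues)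

namespace CyclotomicFermatCMType

/-! ## §0 Elementary facts in `ℤ/N` -/

section Elementary

variable {N : ℕ}

/-- `3 ≠ 0` in `ℤ/N` when `N` is prime to `3` and `ℤ/N` has a non-zero element (private copy of the sibling's). [folklore] -/
private theorem three_ne_zero_fc [NeZero N] (hN3 : Nat.Coprime 3 N) {a : ZMod N} (ha : a ≠ 0) : (3 : ZMod N) ≠ 0 := by
  intro h3
  have h3' : ((3 : ℕ) : ZMod N) = 0 := by exact_mod_cast h3
  rw [ZMod.natCast_eq_zero_iff] at h3'
  rcases (Nat.dvd_prime Nat.prime_three).1 h3' with h | h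
  · subst h
    exact ha (Subsingleton.elim a 0)
  · subst h
    norm_num at hN3

/-- `2 < N` as soon as `N` is prime to `2` and `ℤ/N` has a non-zero element (so `ℚ(ζ_N)` is a CM field). [folklore] -/
private theorem two_lt_level_fc [NeZero N] (hN2 : Nat.Coprime 2 N) {a : ZMod N} (ha : a ≠ 0) : 2 < N := by
  have h0 : N ≠ 0 := NeZero.ne N
  have h1 : N ≠ 1 := by
    rintro rfl
    exact ha (Subsingleton.elim a 0)
  have h2 : N ≠ 2 := by
    rintro rfl
    norm_num at hN2
  omega

/-- In the first family `1 + a + a² = 0`: `a` is a unit (inverse `−1 − a`), `a³ = 1` and `a² = −1 − a`. [folklore] -/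
private theorem firstFamily_facts_fc {a : ZMod N} (h : 1 + a + a ^ 2 = 0) : IsUnit a ∧ a ^ 3 = 1 ∧ a ^ 2 = -1 - a :=
  ⟨IsUnit.of_mul_eq_one (-1 - a) (by linear_combination -h), by linear_combination (a - 1) * h, by linear_combination h⟩

/-- In the first family, `a ≠ 1` forces `a ≠ 0` and `−1 − a ≠ 0`. [folklore] -/
private theorem ne_zero_of_firstFamily_fc {a : ZMod N} (h : 1 + a + a ^ 2 = 0) (ha1 : a ≠ 1) :
    a ≠ 0 ∧ (-1 - a : ZMod N) ≠ 0 := by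
  have hu := (firstFamily_facts_fc h).1
  have ha0 : a ≠ 0 := by
    intro h0
    apply ha1
    have h1 : (1 : ZMod N) = 0 := by simpa [h0] using h
    haveI := subsingleton_of_zero_eq_one h1.symm
    exact Subsingleton.elim a 1
  haveI : Nontrivial (ZMod N) := nontrivial_of_ne a 0 ha0
  refine ⟨ha0, ?_⟩
  rw [← (firstFamily_facts_fc h).2.2]
  exact (hu.pow 2).ne_zero

/-- In the second family `a² = 1`, `a ≠ ±1`: `a` is a unit, `a ≠ 0` and `−1 − a ≠ 0`. [folklore] -/
private theorem ne_zero_of_secondFamily_fc {a : ZMod N} (h : a ^ 2 = 1) (ha1 : a ≠ 1) (ha1' : a ≠ -1) :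
    IsUnit a ∧ a ≠ 0 ∧ (-1 - a : ZMod N) ≠ 0 := by
  have hu : IsUnit a := IsUnit.of_mul_eq_one a (by linear_combination h)
  have ha0 : a ≠ 0 := by
    intro h0
    apply ha1
    have h1 : (1 : ZMod N) = 0 := by
      have : a ^ 2 = 0 := by rw [h0]; ring
      rw [this] at h; exact h.symm
    haveI := subsingleton_of_zero_eq_one h1.symm
    exact Subsingleton.elim a 1
  exact ⟨hu, ha0, fun h0 => ha1' (by linear_combination -h0)⟩

/-- In the second family through the other entry, `(1 + a)² = 1`, `a ≠ 0`: `−1 − a` is a unit and `−1 − a ≠ 0`. [folklore] -/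
private theorem ne_zero_of_secondFamily'_fc {a : ZMod N} (h : (1 + a) ^ 2 = 1) (ha : a ≠ 0) :
    IsUnit (-1 - a : ZMod N) ∧ (-1 - a : ZMod N) ≠ 0 := by
  have hu : IsUnit (-1 - a : ZMod N) := IsUnit.of_mul_eq_one (-1 - a) (by linear_combination h)
  haveI : Nontrivial (ZMod N) := nontrivial_of_ne a 0 ha
  exact ⟨hu, hu.ne_zero⟩

end Elementary

/-! ## §1 The stabiliser `W_{1,a,−1−a}` as an explicit set at every level prime to `6` -/

section Stabiliser

variable {N : ℕ} [NeZero N]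

/-- **The stabiliser table as a membership criterion**: at `N` prime to `6`, for `a, −1−a ≠ 0`, a residue `t` lies in
`W_{1,a,−1−a} = {t ∈ (ℤ/N)ˣ | ct ∈ H ⟺ c ∈ H for all units c}` iff `t = 1`, or `1 + a + a² = 0`, `a ≠ 1`, `t ∈ {a, a²}` (first family), or
`a² = 1`, `a ≠ ±1`, `t = a`, or `(1+a)² = 1`, `a ∉ {0, −2}`, `t = −1 − a` (second family) — the sibling's `fermatCMType_mul_eq_iff_coprimeSix`
("if `w` is in `W_{r,s,t}`, then `H_{r,s,t} = wH_{r,s,t} = H_{⟨w⁻¹r⟩,⟨w⁻¹s⟩,⟨w⁻¹t⟩}` … one deduces that for `w ≠ 1`, either `1 + w + w² = 0` … or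
`w² = 1`"). [cite: KoblitzRohrlich1978, §1 (p. 1184) and proof of Theorem 2 (pp. 1185–1186)] -/
theorem mem_stabilizerResidues_fermat_one_iff_coprimeSix (hN2 : Nat.Coprime 2 N) (hN3 : Nat.Coprime 3 N) {a : ZMod N} (ha : a ≠ 0)
    (ha' : (-1 - a : ZMod N) ≠ 0) (t : ZMod N) :
    t ∈ ((unitResidues N).filter fun t => ∀ c ∈ unitResidues N,
        (c * t ∈ fermatCMType N 1 a (-1 - a) ↔ c ∈ fermatCMType N 1 a (-1 - a))) ↔
      (t = 1 ∨ ((1 + a + a ^ 2 = 0 ∧ a ≠ 1 ∧ (t = a ∨ t = a ^ 2)) ∨ (a ^ 2 = 1 ∧ a ≠ 1 ∧ a ≠ -1 ∧ t = a) ∨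
        ((1 + a) ^ 2 = 1 ∧ a ≠ 0 ∧ a ≠ -2 ∧ t = -1 - a))) := by
  rw [Finset.mem_filter]
  constructor
  · rintro ⟨htU, hstab⟩
    have htu : IsUnit t := (mem_unitResidues_iff_isUnit t).1 htU
    exact (fermatCMType_mul_eq_iff_coprimeSix hN2 hN3 ha ha' htu).1 (fermatCMType_mul_eq_of_forall_mem_unitResidues htu hstab)
  · intro h
    have htu : IsUnit t := by
      rcases h with ht | ⟨hf, -, ht | ht⟩ | ⟨hsq, -, -, ht⟩ | ⟨hsq, -, -, ht⟩ <;> rw [ht]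
      · exact isUnit_one
      · exact (firstFamily_facts_fc hf).1
      · exact (firstFamily_facts_fc hf).1.pow 2
      · exact IsUnit.of_mul_eq_one a (by linear_combination hsq)
      · exact IsUnit.of_mul_eq_one (-1 - a) (by linear_combination hsq)
    have heq := (fermatCMType_mul_eq_iff_coprimeSix hN2 hN3 ha ha' htu).2 h
    refine ⟨(mem_unitResidues_iff_isUnit t).2 htu, fun c _ => ?_⟩
    have h1 : fermatCMType N (t * 1) (t * a) (t * (-1 - a)) = fermatCMType N 1 a (-1 - a) := by rw [mul_one]; exact heq
    have hall := (forall_mem_iff_mul_mem_iff_fermatCMType_mul_eq htu).2 h1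
    rw [mul_comm]
    exact (hall c).symm

/-- **FIRST FAMILY: `W_{1,w,w²} = {1, w, w²}`** at every `N` prime to `6` (`1 + w + w² = 0`, `w ≠ 1`; the triple `(1, w, −1−w)` has
`−1 − w = w²`). [cite: KoblitzRohrlich1978, Theorem 2 (pp. 1185–1186) and §1 (p. 1184)] -/
theorem stabilizerResidues_fermat_one_eq_triple_coprimeSix (hN2 : Nat.Coprime 2 N) (hN3 : Nat.Coprime 3 N) {a : ZMod N}
    (hf : 1 + a + a ^ 2 = 0) (ha1 : a ≠ 1) :
    ((unitResidues N).filter fun t => ∀ c ∈ unitResidues N,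
        (c * t ∈ fermatCMType N 1 a (-1 - a) ↔ c ∈ fermatCMType N 1 a (-1 - a))) = {1, a, a ^ 2} := by
  obtain ⟨ha, ha'⟩ := ne_zero_of_firstFamily_fc hf ha1
  ext t
  rw [mem_stabilizerResidues_fermat_one_iff_coprimeSix hN2 hN3 ha ha', Finset.mem_insert, Finset.mem_insert,
    Finset.mem_singleton]
  constructor
  · rintro (h | ⟨-, -, h | h⟩ | ⟨-, -, -, h⟩ | ⟨-, -, -, h⟩)
    · exact Or.inl h
    · exact Or.inr (Or.inl h)
    · exact Or.inr (Or.inr h)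
    · exact Or.inr (Or.inl h)
    · exact Or.inr (Or.inr (h.trans (firstFamily_facts_fc hf).2.2.symm))
  · rintro (h | h | h)
    · exact Or.inl h
    · exact Or.inr (Or.inl ⟨hf, ha1, Or.inl h⟩)
    · exact Or.inr (Or.inl ⟨hf, ha1, Or.inr h⟩)

/-- `1, a, a²` are pairwise distinct in the first family at a level prime to `3` (`|W| = 3`). [cite: KoblitzRohrlich1978, Theorem 2 (pp. 1185–1186)] -/
theorem card_triple_eq_three_of_firstFamily (hN3 : Nat.Coprime 3 N) {a : ZMod N} (hf : 1 + a + a ^ 2 = 0) (ha1 : a ≠ 1) :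
    ({1, a, a ^ 2} : Finset (ZMod N)).card = 3 := by
  obtain ⟨ha, -⟩ := ne_zero_of_firstFamily_fc hf ha1
  have h3 := three_ne_zero_fc hN3 ha
  refine Finset.card_eq_three.2 ⟨1, a, a ^ 2, Ne.symm ha1, ?_, ?_, rfl⟩
  · intro h
    exact h3 (by linear_combination (a - 1) * h.symm + (2 - a) * hf)
  · intro h
    exact h3 (by linear_combination (2 * a + 1) * h.symm + (3 - 2 * a) * hf)

/-- **`|W_{1,w,w²}| = 3`** at every `N` prime to `6` ("isogenous to a product of `|W_{r,s}|` isomorphic simple factors": three).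
[cite: KoblitzRohrlich1978, §1 (p. 1184) and Theorem 2 (pp. 1185–1186)] -/
theorem card_stabilizerResidues_fermat_one_eq_three_coprimeSix (hN2 : Nat.Coprime 2 N) (hN3 : Nat.Coprime 3 N) {a : ZMod N}
    (hf : 1 + a + a ^ 2 = 0) (ha1 : a ≠ 1) :
    ((unitResidues N).filter fun t => ∀ c ∈ unitResidues N,
        (c * t ∈ fermatCMType N 1 a (-1 - a) ↔ c ∈ fermatCMType N 1 a (-1 - a))).card = 3 := by
  rw [stabilizerResidues_fermat_one_eq_triple_coprimeSix hN2 hN3 hf ha1, card_triple_eq_three_of_firstFamily hN3 hf ha1]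

/-- **SECOND FAMILY: `W_{1,w,−1−w} = {1, w}`** at every `N` prime to `6` (`w² = 1`, `w ≠ ±1`).
[cite: KoblitzRohrlich1978, Theorem 2 (pp. 1185–1186) and §1 (p. 1184)] -/
theorem stabilizerResidues_fermat_one_eq_pair_coprimeSix (hN2 : Nat.Coprime 2 N) (hN3 : Nat.Coprime 3 N) {a : ZMod N}
    (hsq : a ^ 2 = 1) (ha1 : a ≠ 1) (ha1' : a ≠ -1) :
    ((unitResidues N).filter fun t => ∀ c ∈ unitResidues N,
        (c * t ∈ fermatCMType N 1 a (-1 - a) ↔ c ∈ fermatCMType N 1 a (-1 - a))) = {1, a} := by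
  obtain ⟨-, ha, ha'⟩ := ne_zero_of_secondFamily_fc hsq ha1 ha1'
  have h3 := three_ne_zero_fc hN3 ha
  ext t
  rw [mem_stabilizerResidues_fermat_one_iff_coprimeSix hN2 hN3 ha ha', Finset.mem_insert, Finset.mem_singleton]
  constructor
  · rintro (h | ⟨hf, -, h | h⟩ | ⟨-, -, -, h⟩ | ⟨hsq', -, -, -⟩)
    · exact Or.inl h
    · exact Or.inr h
    · exact Or.inl (h.trans hsq)
    · exact Or.inr h
    · exact absurd (by linear_combination (2 * a - 1) * hsq' - (2 * a + 3) * hsq) h3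
  · rintro (h | h)
    · exact Or.inl h
    · exact Or.inr (Or.inr (Or.inl ⟨hsq, ha1, ha1', h⟩))

/-- **`|W_{1,w,−1−w}| = 2`** (`w² = 1`, `w ≠ ±1`) at every `N` prime to `6`. [cite: KoblitzRohrlich1978, §1 (p. 1184) and Theorem 2] -/
theorem card_stabilizerResidues_fermat_one_eq_two_coprimeSix (hN2 : Nat.Coprime 2 N) (hN3 : Nat.Coprime 3 N) {a : ZMod N}
    (hsq : a ^ 2 = 1) (ha1 : a ≠ 1) (ha1' : a ≠ -1) :
    ((unitResidues N).filter fun t => ∀ c ∈ unitResidues N,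
        (c * t ∈ fermatCMType N 1 a (-1 - a) ↔ c ∈ fermatCMType N 1 a (-1 - a))).card = 2 := by
  rw [stabilizerResidues_fermat_one_eq_pair_coprimeSix hN2 hN3 hsq ha1 ha1', Finset.card_pair (Ne.symm ha1)]

/-- **SECOND FAMILY through the non-unit position: `W_{1,a,−1−a} = {1, −1−a}`** when `(1 + a)² = 1`, `a ∉ {0, −2}` (the involution is
`w = −1 − a`, the triple is `{1, w, −1−w}` with `−1 − w = a`). [cite: KoblitzRohrlich1978, Theorem 2 (pp. 1185–1186) and §1 (p. 1184)] -/
theorem stabilizerResidues_fermat_one_eq_pair'_coprimeSix (hN2 : Nat.Coprime 2 N) (hN3 : Nat.Coprime 3 N) {a : ZMod N}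
    (hsq : (1 + a) ^ 2 = 1) (ha : a ≠ 0) (ha2 : a ≠ -2) :
    ((unitResidues N).filter fun t => ∀ c ∈ unitResidues N,
        (c * t ∈ fermatCMType N 1 a (-1 - a) ↔ c ∈ fermatCMType N 1 a (-1 - a))) = {1, -1 - a} := by
  obtain ⟨-, ha'⟩ := ne_zero_of_secondFamily'_fc hsq ha
  have h3 := three_ne_zero_fc hN3 ha
  ext t
  rw [mem_stabilizerResidues_fermat_one_iff_coprimeSix hN2 hN3 ha ha', Finset.mem_insert, Finset.mem_singleton]
  constructor
  · rintro (h | ⟨hf, hne1, -⟩ | ⟨hsq', -, -, -⟩ | ⟨-, -, -, h⟩)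
    · exact Or.inl h
    · exact absurd (by linear_combination hsq - hf) hne1
    · exact absurd (by linear_combination (2 * a - 1) * hsq - (2 * a + 3) * hsq') h3
    · exact Or.inr h
  · rintro (h | h)
    · exact Or.inl h
    · exact Or.inr (Or.inr (Or.inr ⟨hsq, ha, ha2, h⟩))

/-- **`|W_{1,a,−1−a}| = 2`** when `(1 + a)² = 1`, `a ∉ {0, −2}`, at every `N` prime to `6`. [cite: KoblitzRohrlich1978, §1 (p. 1184) and Theorem 2] -/
theorem card_stabilizerResidues_fermat_one_eq_two'_coprimeSix (hN2 : Nat.Coprime 2 N) (hN3 : Nat.Coprime 3 N) {a : ZMod N}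
    (hsq : (1 + a) ^ 2 = 1) (ha : a ≠ 0) (ha2 : a ≠ -2) :
    ((unitResidues N).filter fun t => ∀ c ∈ unitResidues N,
        (c * t ∈ fermatCMType N 1 a (-1 - a) ↔ c ∈ fermatCMType N 1 a (-1 - a))).card = 2 := by
  rw [stabilizerResidues_fermat_one_eq_pair'_coprimeSix hN2 hN3 hsq ha ha2,
    Finset.card_pair (fun h => ha2 (by linear_combination h))]

/-- **Off the two families `W_{1,a,−1−a} = {1}`** at every `N` prime to `6` (Theorem 2: "The only lattices `L_{r,s,t}` which are not simple
are those …"; the sibling's `hasTrivialStabilizer_fermat_one_iff_coprimeSix` as a set equation). [cite: KoblitzRohrlich1978, Theorem 2 (pp. 1185–1186)] -/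
theorem stabilizerResidues_fermat_one_eq_singleton_coprimeSix (hN2 : Nat.Coprime 2 N) (hN3 : Nat.Coprime 3 N) {a : ZMod N}
    (ha : a ≠ 0) (ha' : (-1 - a : ZMod N) ≠ 0) (h₁ : ¬(1 + a + a ^ 2 = 0 ∧ a ≠ 1)) (h₂ : ¬(a ^ 2 = 1 ∧ a ≠ 1 ∧ a ≠ -1))
    (h₃ : ¬((1 + a) ^ 2 = 1 ∧ a ≠ 0 ∧ a ≠ -2)) :
    ((unitResidues N).filter fun t => ∀ c ∈ unitResidues N,
        (c * t ∈ fermatCMType N 1 a (-1 - a) ↔ c ∈ fermatCMType N 1 a (-1 - a))) = {1} := by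
  ext t
  rw [mem_stabilizerResidues_fermat_one_iff_coprimeSix hN2 hN3 ha ha', Finset.mem_singleton]
  constructor
  · rintro (h | ⟨hf, hne, -⟩ | ⟨hsq, hne, hne', -⟩ | ⟨hsq, hne, hne', -⟩)
    · exact h
    · exact absurd ⟨hf, hne⟩ h₁
    · exact absurd ⟨hsq, hne, hne'⟩ h₂
    · exact absurd ⟨hsq, hne, hne'⟩ h₃
  · exact Or.inl

/-- **`|W_{1,a,−1−a}| = 1` off the two families** at every `N` prime to `6`. [cite: KoblitzRohrlich1978, Theorem 2 (pp. 1185–1186)] -/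
theorem card_stabilizerResidues_fermat_one_eq_one_coprimeSix (hN2 : Nat.Coprime 2 N) (hN3 : Nat.Coprime 3 N) {a : ZMod N}
    (ha : a ≠ 0) (ha' : (-1 - a : ZMod N) ≠ 0) (h₁ : ¬(1 + a + a ^ 2 = 0 ∧ a ≠ 1)) (h₂ : ¬(a ^ 2 = 1 ∧ a ≠ 1 ∧ a ≠ -1))
    (h₃ : ¬((1 + a) ^ 2 = 1 ∧ a ≠ 0 ∧ a ≠ -2)) :
    ((unitResidues N).filter fun t => ∀ c ∈ unitResidues N,
        (c * t ∈ fermatCMType N 1 a (-1 - a) ↔ c ∈ fermatCMType N 1 a (-1 - a))).card = 1 := by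
  rw [stabilizerResidues_fermat_one_eq_singleton_coprimeSix hN2 hN3 ha ha' h₁ h₂ h₃, Finset.card_singleton]

/-- **`|W_{1,a,−1−a}| ≤ 3` for every `a` with `a, −1−a ≠ 0`** at a level prime to `6`: the number of (isomorphic) simple factors of
`L_{r,s,t}` with a unit entry is `1`, `2` or `3`. [cite: KoblitzRohrlich1978, §1 (p. 1184) and Theorem 2 (pp. 1185–1186)] -/
theorem card_stabilizerResidues_fermat_one_le_three_coprimeSix (hN2 : Nat.Coprime 2 N) (hN3 : Nat.Coprime 3 N) {a : ZMod N}
    (ha : a ≠ 0) (ha' : (-1 - a : ZMod N) ≠ 0) :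
    ((unitResidues N).filter fun t => ∀ c ∈ unitResidues N,
        (c * t ∈ fermatCMType N 1 a (-1 - a) ↔ c ∈ fermatCMType N 1 a (-1 - a))).card ≤ 3 := by
  by_cases h₁ : 1 + a + a ^ 2 = 0 ∧ a ≠ 1
  · rw [card_stabilizerResidues_fermat_one_eq_three_coprimeSix hN2 hN3 h₁.1 h₁.2]
  by_cases h₂ : a ^ 2 = 1 ∧ a ≠ 1 ∧ a ≠ -1
  · rw [card_stabilizerResidues_fermat_one_eq_two_coprimeSix hN2 hN3 h₂.1 h₂.2.1 h₂.2.2]; norm_num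
  by_cases h₃ : (1 + a) ^ 2 = 1 ∧ a ≠ 0 ∧ a ≠ -2
  · rw [card_stabilizerResidues_fermat_one_eq_two'_coprimeSix hN2 hN3 h₃.1 h₃.2.1 h₃.2.2]; norm_num
  rw [card_stabilizerResidues_fermat_one_eq_one_coprimeSix hN2 hN3 ha ha' h₁ h₂ h₃]; norm_num

end Stabiliser

/-! ## §2 Unit scaling of the stabiliser; every admissible primitive triple has `|W| ≤ 3` -/

section Scaling

variable {N : ℕ} [NeZero N]

/-- **`W_{uτ} = W_τ` for a unit `u`** (any level): `H_{ur,us,ut} = u⁻¹H_{r,s,t}` and `(ℤ/N)ˣ` is commutative ("`H_{r,s} = hH_{⟨hr⟩,⟨hs⟩}`").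
[cite: KoblitzRohrlich1978, §1 (pp. 1183–1184)] -/
theorem stabilizerResidues_fermatCMType_mul_eq {r s t u : ZMod N} (hu : IsUnit u) :
    ((unitResidues N).filter fun x => ∀ c ∈ unitResidues N,
        (c * x ∈ fermatCMType N (u * r) (u * s) (u * t) ↔ c ∈ fermatCMType N (u * r) (u * s) (u * t))) =
      ((unitResidues N).filter fun x => ∀ c ∈ unitResidues N, (c * x ∈ fermatCMType N r s t ↔ c ∈ fermatCMType N r s t)) := by
  ext x
  simp only [Finset.mem_filter]
  refine and_congr_right fun _ => ⟨fun h c hc => ?_, fun h c hc => ?_⟩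
  · obtain ⟨v, hv⟩ := hu.exists_left_inv
    have hvU : IsUnit v := IsUnit.of_mul_eq_one u hv
    have hcU : IsUnit c := (mem_unitResidues_iff_isUnit c).1 hc
    have h' := h (v * c) ((mem_unitResidues_iff_isUnit _).2 (hvU.mul hcU))
    rw [mem_fermatCMType_mul_iff_of_isUnit hu, mem_fermatCMType_mul_iff_of_isUnit hu,
      show u * (v * c * x) = c * x by rw [← mul_assoc, ← mul_assoc, mul_comm u v, hv, one_mul],
      show u * (v * c) = c by rw [← mul_assoc, mul_comm u v, hv, one_mul]] at h'
    exact h'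
  · have hcU : IsUnit c := (mem_unitResidues_iff_isUnit c).1 hc
    rw [mem_fermatCMType_mul_iff_of_isUnit hu, mem_fermatCMType_mul_iff_of_isUnit hu, ← mul_assoc]
    exact h (u * c) ((mem_unitResidues_iff_isUnit _).2 (hu.mul hcU))

/-- `H_{(a,b,c)} = H_{(b,c,a)}` (cyclic permutation; private copy of the siblings' swaps). [cite: KoblitzRohrlich1978, §1 (p. 1184)] -/
private theorem fermatCMType_rotate_fc (a b c : ZMod N) : fermatCMType N a b c = fermatCMType N b c a := by
  ext x
  simp only [fermatCMType, Finset.mem_filter, Finset.mem_univ, true_and]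
  constructor <;> rintro ⟨h1, h2⟩ <;> exact ⟨h1, by omega⟩

/-- **Normal form**: if `r` is a unit with `vr = 1`, then `H_{r,s,t} = H_{r·(1, vs, −1−vs)}` for `r + s + t = 0`. [cite: KoblitzRohrlich1978, §1 (p. 1184: "if g.c.d.`(r, N) = 1`, we may assume that the pair is actually `(1, s)`")] -/
theorem fermatCMType_eq_mul_normalForm {r s t v : ZMod N} (hv : v * r = 1) (hrst : r + s + t = 0) :
    fermatCMType N r s t = fermatCMType N (r * 1) (r * (v * s)) (r * (-1 - v * s)) := by
  have ht : t = -r - s := by linear_combination hrst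
  congr 1
  · rw [mul_one]
  · rw [← mul_assoc, mul_comm r v, hv, one_mul]
  · rw [ht]; linear_combination s * hv

/-- **Every admissible PRIMITIVE triple at a level prime to `6` has `|W_τ| ≤ 3`**: with a unit entry, normalise to `(1, a, −1−a)` (§1);
with no unit entry `W_τ = {1}` ("each have a common factor with `M` … whence `w ≡ 1`", the sibling's `hasTrivialStabilizer_of_not_isUnit`).
[cite: KoblitzRohrlich1978, §1 (p. 1184) and Theorem 2 with its proof (pp. 1185–1186)] -/
theorem card_stabilizerResidues_fermatCMType_le_three_coprimeSix (hN2 : Nat.Coprime 2 N) (hN3 : Nat.Coprime 3 N) {r s t : ZMod N}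
    (hr : r ≠ 0) (hs : s ≠ 0) (ht : t ≠ 0) (hrst : r + s + t = 0)
    (hprim : ∀ q : ℕ, q.Prime → q ∣ N → ¬(q ∣ r.val ∧ q ∣ s.val ∧ q ∣ t.val)) :
    ((unitResidues N).filter fun x => ∀ c ∈ unitResidues N,
        (c * x ∈ fermatCMType N r s t ↔ c ∈ fermatCMType N r s t)).card ≤ 3 := by
  -- a unit entry: normalise through it
  have key : ∀ {r s t : ZMod N}, IsUnit r → s ≠ 0 → t ≠ 0 → r + s + t = 0 →
      ((unitResidues N).filter fun x => ∀ c ∈ unitResidues N,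
        (c * x ∈ fermatCMType N r s t ↔ c ∈ fermatCMType N r s t)).card ≤ 3 := by
    intro r s t hru hs ht hrst
    obtain ⟨v, hv⟩ := hru.exists_left_inv
    have hvU : IsUnit v := IsUnit.of_mul_eq_one r hv
    have ha : v * s ≠ 0 := fun h => hs (hvU.mul_right_eq_zero.1 h)
    have ha' : (-1 - v * s : ZMod N) ≠ 0 := by
      have htv : -1 - v * s = v * t := by
        have : t = -r - s := by linear_combination hrst
        rw [this]; linear_combination hv
      rw [htv]
      exact fun h => ht (hvU.mul_right_eq_zero.1 h)
    rw [fermatCMType_eq_mul_normalForm hv hrst, stabilizerResidues_fermatCMType_mul_eq hru]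
    exact card_stabilizerResidues_fermat_one_le_three_coprimeSix hN2 hN3 ha ha'
  by_cases hru : IsUnit r
  · exact key hru hs ht hrst
  by_cases hsu : IsUnit s
  · rw [fermatCMType_rotate_fc r s t]
    exact key hsu ht hr (by linear_combination hrst)
  -- no unit among `r`, `s`: `W = {1}`
  have hW := hasTrivialStabilizer_of_not_isUnit hN2 hN3 hr hs ht hrst hprim hru hsu
  have h1 : ((unitResidues N).filter fun x => ∀ c ∈ unitResidues N,
      (c * x ∈ fermatCMType N r s t ↔ c ∈ fermatCMType N r s t)) ⊆ {1} := by
    intro x hx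
    rw [Finset.mem_singleton]
    exact hW x (Finset.mem_filter.1 hx).1 (Finset.mem_filter.1 hx).2
  exact (Finset.card_le_card h1).trans (by rw [Finset.card_singleton]; norm_num)

end Scaling

/-! ## §3 On abelian varieties: `A ∼ B³` (first family), `A ∼ B²` (second family), `h ≤ 3` simple factors in general -/

section Varieties

variable {N : ℕ} [NeZero N] {L : Type} [Field L] [NumberField L] [IsCyclotomicExtension {N} ℚ L]
  {a : ZMod N}
  {hS : ∀ c : ZMod N, c.val.Coprime N → (c ∈ fermatCMType N 1 a (-1 - a) ↔ -c ∉ fermatCMType N 1 a (-1 - a))}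
  {A : AbelianVariety ℂ} {ι : 𝓞 L →+* End A} {θ : L →+* Module.End ℂ (complexBetti A.X 1)}

/-- The residue set of `Φ_{H_{1,a,−1−a}}` is `H_{1,a,−1−a}`. [cite: Shimura1998, §8.4 Example (1)] -/
theorem residueSet_cmTypeOfResidues_fermat_one :
    residueSet N (cmTypeOfResidues (L := L) (fermatCMType N 1 a (-1 - a)) hS) = fermatCMType N 1 a (-1 - a) :=
  residueSet_cmTypeOfResidues N (isCMResidueSet_fermatCMType hS) _

/-- `|W|` of the CM type `Φ_{H_{1,w,w²}}` is `3` (first family, residue-set form). [cite: KoblitzRohrlich1978, §1 (p. 1184) and Theorem 2] -/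
theorem card_stabilizerResidues_cmTypeOfResidues_fermat_one_eq_three (hN2 : Nat.Coprime 2 N) (hN3 : Nat.Coprime 3 N)
    (hf : 1 + a + a ^ 2 = 0) (ha1 : a ≠ 1) :
    ((unitResidues N).filter fun t => ∀ c ∈ unitResidues N,
        (c * t ∈ residueSet N (cmTypeOfResidues (L := L) (fermatCMType N 1 a (-1 - a)) hS) ↔
          c ∈ residueSet N (cmTypeOfResidues (L := L) (fermatCMType N 1 a (-1 - a)) hS))).card = 3 := by
  rw [residueSet_cmTypeOfResidues_fermat_one]
  exact card_stabilizerResidues_fermat_one_eq_three_coprimeSix hN2 hN3 hf ha1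

/-- `|W|` of the CM type `Φ_{H_{1,w,−1−w}}` is `2` (second family, residue-set form). [cite: KoblitzRohrlich1978, §1 (p. 1184) and Theorem 2] -/
theorem card_stabilizerResidues_cmTypeOfResidues_fermat_one_eq_two (hN2 : Nat.Coprime 2 N) (hN3 : Nat.Coprime 3 N)
    (hsq : a ^ 2 = 1) (ha1 : a ≠ 1) (ha1' : a ≠ -1) :
    ((unitResidues N).filter fun t => ∀ c ∈ unitResidues N,
        (c * t ∈ residueSet N (cmTypeOfResidues (L := L) (fermatCMType N 1 a (-1 - a)) hS) ↔
          c ∈ residueSet N (cmTypeOfResidues (L := L) (fermatCMType N 1 a (-1 - a)) hS))).card = 2 := by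
  rw [residueSet_cmTypeOfResidues_fermat_one]
  exact card_stabilizerResidues_fermat_one_eq_two_coprimeSix hN2 hN3 hsq ha1 ha1'

/-- `|W|` of `Φ_{H_{1,a,−1−a}}` is `2` when `(1 + a)² = 1`, `a ∉ {0, −2}` (residue-set form). [cite: KoblitzRohrlich1978, §1 (p. 1184) and Theorem 2] -/
theorem card_stabilizerResidues_cmTypeOfResidues_fermat_one_eq_two' (hN2 : Nat.Coprime 2 N) (hN3 : Nat.Coprime 3 N)
    (hsq : (1 + a) ^ 2 = 1) (ha : a ≠ 0) (ha2 : a ≠ -2) :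
    ((unitResidues N).filter fun t => ∀ c ∈ unitResidues N,
        (c * t ∈ residueSet N (cmTypeOfResidues (L := L) (fermatCMType N 1 a (-1 - a)) hS) ↔
          c ∈ residueSet N (cmTypeOfResidues (L := L) (fermatCMType N 1 a (-1 - a)) hS))).card = 2 := by
  rw [residueSet_cmTypeOfResidues_fermat_one]
  exact card_stabilizerResidues_fermat_one_eq_two'_coprimeSix hN2 hN3 hsq ha ha2

/-- **KOBLITZ–ROHRLICH p. 1184 FOR THE FIRST FAMILY `{1, w, w²}` AT EVERY LEVEL `N` PRIME TO `6`** (`1 + w + w² = 0`, `w ≠ 1`): every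
abelian variety `A` of type `(ℚ(ζ_N); Φ_{H_{1,w,w²}})` — e.g. the factor `A_{1,w}` of the Jacobian of `xᴺ + yᴺ = 1` — is isogenous to the
CUBE `B × B × B` of a SIMPLE abelian variety `B` of dimension `φ(N)/6` with complex multiplication by the CM subfield `K₁ ⊂ ℚ(ζ_N)` of
index `3` («the fixed field of `W`»), `B` of the primitive type `Φ₁` of `K₁` inducing `Φ_{H_{1,w,w²}}` («CM-type equal to `H/W`»); the
isogeny is `𝓞_{K₁}`-equivariant.  (The prime-level case is the sibling's `exists_isIsogeny_cube_simple_of_fermat`.)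
[cite: KoblitzRohrlich1978, §1 (p. 1184) and Theorem 2 (pp. 1185–1186)] [cite: Shimura1998, §8.2 Prop. 26, §6.2 Thm. 3]
[cite: MilneCM2006, Ch. I §3, proof of Prop. 3.13] -/
theorem exists_isIsogeny_cube_simple_of_fermat_one_coprimeSix (hN2 : Nat.Coprime 2 N) (hN3 : Nat.Coprime 3 N)
    (hf : 1 + a + a ^ 2 = 0) (ha1 : a ≠ 1)
    (hA : IsCMTypeRealisation (cmTypeOfResidues (L := L) (fermatCMType N 1 a (-1 - a)) hS) A ι θ) :
    ∃ (K₁ : IntermediateField ℚ L) (Φ₁ : CMType K₁), IsCMField K₁ ∧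
      inducedCMType (algebraMap K₁ L) Φ₁ = cmTypeOfResidues (L := L) (fermatCMType N 1 a (-1 - a)) hS ∧
      (∀ s t : K₁ →+* ℂ,
        (∀ τ : ℂ ≃+* ℂ, (τ : ℂ →+* ℂ).comp s ∈ Φ₁.1 ↔ (τ : ℂ →+* ℂ).comp t ∈ Φ₁.1) → s = t) ∧
      Module.finrank K₁ L = 3 ∧
      ∃ (B : AbelianVariety ℂ) (ιB : 𝓞 K₁ →+* End B) (θB : K₁ →+* Module.End ℂ (complexBetti B.X 1)),
        IsCMTypeRealisation Φ₁ B ιB θB ∧ B.IsSimple ∧ 6 * B.dim = N.totient ∧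
        ∃ (P : AbelianVariety ℂ) (π : Fin 3 → (P ⟶ B)), Nonempty (IsLimit (Fan.mk P π)) ∧
          ∃ g : A ⟶ P, IsIsogeny g ∧
            ∀ j (b : 𝓞 K₁), ι (RingOfIntegers.mapRingHom (algebraMap K₁ L : K₁ →+* L) b) ≫ (g ≫ π j) =
              (g ≫ π j) ≫ ιB b := by
  obtain ⟨ha, -⟩ := ne_zero_of_firstFamily_fc hf ha1
  haveI : IsCMField L := IsCyclotomicExtension.Rat.isCMField L (S := {N}) ⟨N, rfl, two_lt_level_fc hN2 ha⟩
  have H := exists_isIsogeny_power_simple_cyclotomic (N := N) hA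
  rw [card_stabilizerResidues_cmTypeOfResidues_fermat_one_eq_three hN2 hN3 hf ha1] at H
  obtain ⟨K₁, Φ₁, hCM, h₁, hp₁, hW, B, ιB, θB, hB, hs, hdim, P, π, hP, g, hg, hequiv⟩ := H
  exact ⟨K₁, Φ₁, hCM, h₁, hp₁, hW, B, ιB, θB, hB, hs, by omega, P, π, hP, g, hg, hequiv⟩

/-- **Short form, first family**: every abelian variety of type `Φ_{H_{1,w,w²}}` (`N` prime to `6`, `1 + w + w² = 0`, `w ≠ 1`) is isogenous to
`B³` with `B` SIMPLE of CM type and `6 dim B = φ(N)`. [cite: KoblitzRohrlich1978, §1 (p. 1184) and Theorem 2] -/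
theorem exists_isIsogeny_cube_simple_of_fermat_one_coprimeSix' (hN2 : Nat.Coprime 2 N) (hN3 : Nat.Coprime 3 N)
    (hf : 1 + a + a ^ 2 = 0) (ha1 : a ≠ 1)
    (hA : IsCMTypeRealisation (cmTypeOfResidues (L := L) (fermatCMType N 1 a (-1 - a)) hS) A ι θ) :
    ∃ (B : AbelianVariety ℂ), B.IsSimple ∧ Milne1999.IsOfCMType B ∧ 6 * B.dim = N.totient ∧
      ∃ (P : AbelianVariety ℂ) (π : Fin 3 → (P ⟶ B)), Nonempty (IsLimit (Fan.mk P π)) ∧ ∃ g : A ⟶ P, IsIsogeny g := by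
  obtain ⟨K₁, Φ₁, -, -, -, -, B, ιB, θB, hB, hs, hdim, P, π, hP, g, hg, -⟩ :=
    exists_isIsogeny_cube_simple_of_fermat_one_coprimeSix hN2 hN3 hf ha1 hA
  exact ⟨B, hs, isOfCMType_of_isCMTypeRealisation hB, hdim, P, π, hP, g, hg⟩

/-- **KOBLITZ–ROHRLICH p. 1184 FOR THE SECOND FAMILY `{1, w, −1−w}` AT EVERY LEVEL `N` PRIME TO `6`** (`w² = 1`, `w ≠ ±1`; the family
needs two distinct primes in `N`): every abelian variety `A` of type `(ℚ(ζ_N); Φ_{H_{1,w,−1−w}})` is isogenous to the SQUARE `B × B` of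
a SIMPLE abelian variety `B` of dimension `φ(N)/4` with complex multiplication by the CM subfield `K₁ ⊂ ℚ(ζ_N)` of index `2` («the fixed
field of `W = {1, w}`»), `B` of the primitive type `Φ₁` of `K₁` inducing `Φ_{H_{1,w,−1−w}}`; the isogeny is `𝓞_{K₁}`-equivariant.
[cite: KoblitzRohrlich1978, §1 (p. 1184) and Theorem 2 (pp. 1185–1186)] [cite: Shimura1998, §8.2 Prop. 26, §6.2 Thm. 3]
[cite: MilneCM2006, Ch. I §3, proof of Prop. 3.13] -/
theorem exists_isIsogeny_square_simple_of_fermat_one_coprimeSix (hN2 : Nat.Coprime 2 N) (hN3 : Nat.Coprime 3 N)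
    (hsq : a ^ 2 = 1) (ha1 : a ≠ 1) (ha1' : a ≠ -1)
    (hA : IsCMTypeRealisation (cmTypeOfResidues (L := L) (fermatCMType N 1 a (-1 - a)) hS) A ι θ) :
    ∃ (K₁ : IntermediateField ℚ L) (Φ₁ : CMType K₁), IsCMField K₁ ∧
      inducedCMType (algebraMap K₁ L) Φ₁ = cmTypeOfResidues (L := L) (fermatCMType N 1 a (-1 - a)) hS ∧
      (∀ s t : K₁ →+* ℂ,
        (∀ τ : ℂ ≃+* ℂ, (τ : ℂ →+* ℂ).comp s ∈ Φ₁.1 ↔ (τ : ℂ →+* ℂ).comp t ∈ Φ₁.1) → s = t) ∧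
      Module.finrank K₁ L = 2 ∧
      ∃ (B : AbelianVariety ℂ) (ιB : 𝓞 K₁ →+* End B) (θB : K₁ →+* Module.End ℂ (complexBetti B.X 1)),
        IsCMTypeRealisation Φ₁ B ιB θB ∧ B.IsSimple ∧ 4 * B.dim = N.totient ∧
        ∃ (P : AbelianVariety ℂ) (π : Fin 2 → (P ⟶ B)), Nonempty (IsLimit (Fan.mk P π)) ∧
          ∃ g : A ⟶ P, IsIsogeny g ∧
            ∀ j (b : 𝓞 K₁), ι (RingOfIntegers.mapRingHom (algebraMap K₁ L : K₁ →+* L) b) ≫ (g ≫ π j) =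
              (g ≫ π j) ≫ ιB b := by
  obtain ⟨-, ha, -⟩ := ne_zero_of_secondFamily_fc hsq ha1 ha1'
  haveI : IsCMField L := IsCyclotomicExtension.Rat.isCMField L (S := {N}) ⟨N, rfl, two_lt_level_fc hN2 ha⟩
  have H := exists_isIsogeny_power_simple_cyclotomic (N := N) hA
  rw [card_stabilizerResidues_cmTypeOfResidues_fermat_one_eq_two hN2 hN3 hsq ha1 ha1'] at H
  obtain ⟨K₁, Φ₁, hCM, h₁, hp₁, hW, B, ιB, θB, hB, hs, hdim, P, π, hP, g, hg, hequiv⟩ := H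
  exact ⟨K₁, Φ₁, hCM, h₁, hp₁, hW, B, ιB, θB, hB, hs, by omega, P, π, hP, g, hg, hequiv⟩

/-- **The second family through the non-unit position** (`(1 + a)² = 1`, `a ∉ {0, −2}`; the involution is `w = −1 − a`): every abelian
variety of type `Φ_{H_{1,a,−1−a}}` is `𝓞_{K₁}`-equivariantly isogenous to `B × B`, `B` SIMPLE with `4 dim B = φ(N)`, `[ℚ(ζ_N) : K₁] = 2`.
[cite: KoblitzRohrlich1978, §1 (p. 1184) and Theorem 2 (pp. 1185–1186)] [cite: Shimura1998, §8.2 Prop. 26, §6.2 Thm. 3] -/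
theorem exists_isIsogeny_square_simple_of_fermat_one_coprimeSix_of_sq' (hN2 : Nat.Coprime 2 N) (hN3 : Nat.Coprime 3 N)
    (hsq : (1 + a) ^ 2 = 1) (ha : a ≠ 0) (ha2 : a ≠ -2)
    (hA : IsCMTypeRealisation (cmTypeOfResidues (L := L) (fermatCMType N 1 a (-1 - a)) hS) A ι θ) :
    ∃ (K₁ : IntermediateField ℚ L) (Φ₁ : CMType K₁), IsCMField K₁ ∧
      inducedCMType (algebraMap K₁ L) Φ₁ = cmTypeOfResidues (L := L) (fermatCMType N 1 a (-1 - a)) hS ∧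
      (∀ s t : K₁ →+* ℂ,
        (∀ τ : ℂ ≃+* ℂ, (τ : ℂ →+* ℂ).comp s ∈ Φ₁.1 ↔ (τ : ℂ →+* ℂ).comp t ∈ Φ₁.1) → s = t) ∧
      Module.finrank K₁ L = 2 ∧
      ∃ (B : AbelianVariety ℂ) (ιB : 𝓞 K₁ →+* End B) (θB : K₁ →+* Module.End ℂ (complexBetti B.X 1)),
        IsCMTypeRealisation Φ₁ B ιB θB ∧ B.IsSimple ∧ 4 * B.dim = N.totient ∧
        ∃ (P : AbelianVariety ℂ) (π : Fin 2 → (P ⟶ B)), Nonempty (IsLimit (Fan.mk P π)) ∧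
          ∃ g : A ⟶ P, IsIsogeny g ∧
            ∀ j (b : 𝓞 K₁), ι (RingOfIntegers.mapRingHom (algebraMap K₁ L : K₁ →+* L) b) ≫ (g ≫ π j) =
              (g ≫ π j) ≫ ιB b := by
  haveI : IsCMField L := IsCyclotomicExtension.Rat.isCMField L (S := {N}) ⟨N, rfl, two_lt_level_fc hN2 ha⟩
  have H := exists_isIsogeny_power_simple_cyclotomic (N := N) hA
  rw [card_stabilizerResidues_cmTypeOfResidues_fermat_one_eq_two' hN2 hN3 hsq ha ha2] at H
  obtain ⟨K₁, Φ₁, hCM, h₁, hp₁, hW, B, ιB, θB, hB, hs, hdim, P, π, hP, g, hg, hequiv⟩ := H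
  exact ⟨K₁, Φ₁, hCM, h₁, hp₁, hW, B, ιB, θB, hB, hs, by omega, P, π, hP, g, hg, hequiv⟩

/-- **Short form, second family**: every abelian variety of type `Φ_{H_{1,w,−1−w}}` (`N` prime to `6`, `w² = 1`, `w ≠ ±1`) is isogenous to
`B²` with `B` SIMPLE of CM type and `4 dim B = φ(N)`. [cite: KoblitzRohrlich1978, §1 (p. 1184) and Theorem 2] -/
theorem exists_isIsogeny_square_simple_of_fermat_one_coprimeSix' (hN2 : Nat.Coprime 2 N) (hN3 : Nat.Coprime 3 N)
    (hsq : a ^ 2 = 1) (ha1 : a ≠ 1) (ha1' : a ≠ -1)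
    (hA : IsCMTypeRealisation (cmTypeOfResidues (L := L) (fermatCMType N 1 a (-1 - a)) hS) A ι θ) :
    ∃ (B : AbelianVariety ℂ), B.IsSimple ∧ Milne1999.IsOfCMType B ∧ 4 * B.dim = N.totient ∧
      ∃ (P : AbelianVariety ℂ) (π : Fin 2 → (P ⟶ B)), Nonempty (IsLimit (Fan.mk P π)) ∧ ∃ g : A ⟶ P, IsIsogeny g := by
  obtain ⟨K₁, Φ₁, -, -, -, -, B, ιB, θB, hB, hs, hdim, P, π, hP, g, hg, -⟩ :=
    exists_isIsogeny_square_simple_of_fermat_one_coprimeSix hN2 hN3 hsq ha1 ha1' hA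
  exact ⟨B, hs, isOfCMType_of_isCMTypeRealisation hB, hdim, P, π, hP, g, hg⟩

end Varieties

section Count

variable {N : ℕ} [NeZero N] {L : Type} [Field L] [NumberField L] [IsCyclotomicExtension {N} ℚ L]
  {r s t : ZMod N}
  {hS : ∀ c : ZMod N, c.val.Coprime N → (c ∈ fermatCMType N r s t ↔ -c ∉ fermatCMType N r s t)}
  {A : AbelianVariety ℂ} {ι : 𝓞 L →+* End A} {θ : L →+* Module.End ℂ (complexBetti A.X 1)}

/-- **THE NUMBER OF SIMPLE FACTORS IS `1`, `2` OR `3`**: at every level `N` prime to `6`, every abelian variety `A` of type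
`(ℚ(ζ_N); Φ_{H_τ})` for an admissible PRIMITIVE triple `τ = (r, s, t)` is `𝓞_{K₁}`-equivariantly isogenous to `B^h` with `B` SIMPLE of the
primitive sub-type `(K₁; Φ₁)`, `[ℚ(ζ_N) : K₁] = h`, `2h · dim B = φ(N)`, and `1 ≤ h ≤ 3` (`h = |W_τ|`: K–R's "product of `|W_{r,s}|`
isomorphic simple factors" with Theorem 2's bound on `W`). [cite: KoblitzRohrlich1978, §1 (p. 1184) and Theorem 2 (pp. 1185–1186)]
[cite: Shimura1998, §8.2 Prop. 26, §6.2 Thm. 3] [cite: MilneCM2006, Ch. I §3, proof of Prop. 3.13] -/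
theorem exists_isIsogeny_power_simple_le_three_coprimeSix (hN2 : Nat.Coprime 2 N) (hN3 : Nat.Coprime 3 N)
    (hr : r ≠ 0) (hs : s ≠ 0) (ht : t ≠ 0) (hrst : r + s + t = 0)
    (hprim : ∀ q : ℕ, q.Prime → q ∣ N → ¬(q ∣ r.val ∧ q ∣ s.val ∧ q ∣ t.val))
    (hA : IsCMTypeRealisation (cmTypeOfResidues (L := L) (fermatCMType N r s t) hS) A ι θ) :
    ∃ h : ℕ, 0 < h ∧ h ≤ 3 ∧
      ∃ (K₁ : IntermediateField ℚ L) (Φ₁ : CMType K₁), IsCMField K₁ ∧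
        inducedCMType (algebraMap K₁ L) Φ₁ = cmTypeOfResidues (L := L) (fermatCMType N r s t) hS ∧
        (∀ s t : K₁ →+* ℂ,
          (∀ τ : ℂ ≃+* ℂ, (τ : ℂ →+* ℂ).comp s ∈ Φ₁.1 ↔ (τ : ℂ →+* ℂ).comp t ∈ Φ₁.1) → s = t) ∧
        Module.finrank K₁ L = h ∧
        ∃ (B : AbelianVariety ℂ) (ιB : 𝓞 K₁ →+* End B) (θB : K₁ →+* Module.End ℂ (complexBetti B.X 1)),
          IsCMTypeRealisation Φ₁ B ιB θB ∧ B.IsSimple ∧ 2 * B.dim * h = N.totient ∧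
          ∃ (P : AbelianVariety ℂ) (π : Fin h → (P ⟶ B)), Nonempty (IsLimit (Fan.mk P π)) ∧
            ∃ g : A ⟶ P, IsIsogeny g ∧
              ∀ j (b : 𝓞 K₁), ι (RingOfIntegers.mapRingHom (algebraMap K₁ L : K₁ →+* L) b) ≫ (g ≫ π j) =
                (g ≫ π j) ≫ ιB b := by
  haveI : IsCMField L := IsCyclotomicExtension.Rat.isCMField L (S := {N}) ⟨N, rfl, two_lt_level_fc hN2 hr⟩
  obtain ⟨K₁, Φ₁, hCM, h₁, hp₁, hW, B, ιB, θB, hB, hsB, hdim, P, π, hP, g, hg, hequiv⟩ :=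
    exists_isIsogeny_power_simple_cyclotomic (N := N) hA
  refine ⟨_, ?_, ?_, K₁, Φ₁, hCM, h₁, hp₁, hW, B, ιB, θB, hB, hsB, hdim, P, π, hP, g, hg, hequiv⟩
  · exact Finset.card_pos.2 ⟨1, one_mem_stabilizerResidues (N := N) _⟩
  · rw [residueSet_cmTypeOfResidues N (isCMResidueSet_fermatCMType hS)]
    exact card_stabilizerResidues_fermatCMType_le_three_coprimeSix hN2 hN3 hr hs ht hrst hprim

end Count

/-! ## §4 Non-vacuity: `N = 35` (second family, `w = 6`) and `N = 91` (both families, `w = 9` and `w = 27`) -/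

section Instances

/-- `6² ≡ 1`, `6 ≢ ±1 (mod 35)`; `35` is prime to `6` (kernel check). [cite: KoblitzRohrlich1978, Theorem 2 (p. 1186)] -/
theorem secondFamily_thirtyFive :
    (6 : ZMod 35) ^ 2 = 1 ∧ (6 : ZMod 35) ≠ 1 ∧ (6 : ZMod 35) ≠ -1 ∧ Nat.Coprime 2 35 ∧ Nat.Coprime 3 35 := by
  refine ⟨by decide, by decide, by decide, by norm_num, by norm_num⟩

/-- `1 + 9 + 9² ≡ 0`, `9 ≢ 1`, `27² ≡ 1`, `27 ≢ ±1 (mod 91)`; `91` is prime to `6` (kernel check). [cite: KoblitzRohrlich1978, Theorem 2 (p. 1186)] -/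
theorem families_ninetyOne :
    ((1 : ZMod 91) + 9 + 9 ^ 2 = 0 ∧ (9 : ZMod 91) ≠ 1) ∧ ((27 : ZMod 91) ^ 2 = 1 ∧ (27 : ZMod 91) ≠ 1 ∧ (27 : ZMod 91) ≠ -1) ∧
      Nat.Coprime 2 91 ∧ Nat.Coprime 3 91 := by
  refine ⟨⟨by decide, by decide⟩, ⟨by decide, by decide, by decide⟩, by norm_num, by norm_num⟩

variable {L : Type} [Field L] [NumberField L]

/-- **Non-vacuity at `35`** (`w = 6`): there IS a `12`-dimensional abelian variety of type `(ℚ(ζ₃₅); Φ_{H_{1,6,28}})`, and every such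
variety is isogenous to `B × B` for a SIMPLE abelian SIXFOLD `B` of CM type. [cite: KoblitzRohrlich1978, §1 (p. 1184) and Theorem 2 (p. 1186)]
[cite: Shimura1998, §6.2 Thm. 3] -/
theorem exists_realisation_isIsogeny_square_thirtyFive [IsCyclotomicExtension {35} ℚ L] :
    ∃ (hS : ∀ c : ZMod 35, c.val.Coprime 35 → (c ∈ fermatCMType 35 1 6 (-1 - 6) ↔ -c ∉ fermatCMType 35 1 6 (-1 - 6)))
      (A : AbelianVariety ℂ) (ι : 𝓞 L →+* End A) (θ : L →+* Module.End ℂ (complexBetti A.X 1)),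
      IsCMTypeRealisation (cmTypeOfResidues (L := L) (fermatCMType 35 1 6 (-1 - 6)) hS) A ι θ ∧ A.dim = 12 ∧
      ∃ (B : AbelianVariety ℂ), B.IsSimple ∧ Milne1999.IsOfCMType B ∧ B.dim = 6 ∧
        ∃ (P : AbelianVariety ℂ) (π : Fin 2 → (P ⟶ B)), Nonempty (IsLimit (Fan.mk P π)) ∧ ∃ g : A ⟶ P, IsIsogeny g := by
  obtain ⟨hsq, h1, h1', hN2, hN3⟩ := secondFamily_thirtyFive
  obtain ⟨hS, A, ι, θ, hA, hd⟩ := exists_isCMTypeRealisation_fermat (L := L) (M := 35) (by norm_num)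
    (r := 1) (s := 6) (t := -1 - 6) (by decide) (by decide) (by decide) (by decide)
  obtain ⟨B, hs, hcm, hdim, P, π, hP, g, hg⟩ := exists_isIsogeny_square_simple_of_fermat_one_coprimeSix' hN2 hN3 hsq h1 h1' hA
  have htot : Nat.totient 35 = 24 := by decide
  exact ⟨hS, A, ι, θ, hA, by rw [hd, htot], B, hs, hcm, by omega, P, π, hP, g, hg⟩

/-- **Non-vacuity at `91`, first family** (`w = 9`, `9² = 81`): there IS a `36`-dimensional abelian variety of type
`(ℚ(ζ₉₁); Φ_{H_{1,9,81}})`, and every such variety is isogenous to `B × B × B` for a SIMPLE `12`-dimensional `B` of CM type.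
[cite: KoblitzRohrlich1978, §1 (p. 1184) and Theorem 2 (p. 1186)] [cite: Shimura1998, §6.2 Thm. 3] -/
theorem exists_realisation_isIsogeny_cube_ninetyOne [IsCyclotomicExtension {91} ℚ L] :
    ∃ (hS : ∀ c : ZMod 91, c.val.Coprime 91 → (c ∈ fermatCMType 91 1 9 (-1 - 9) ↔ -c ∉ fermatCMType 91 1 9 (-1 - 9)))
      (A : AbelianVariety ℂ) (ι : 𝓞 L →+* End A) (θ : L →+* Module.End ℂ (complexBetti A.X 1)),
      IsCMTypeRealisation (cmTypeOfResidues (L := L) (fermatCMType 91 1 9 (-1 - 9)) hS) A ι θ ∧ A.dim = 36 ∧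
      ∃ (B : AbelianVariety ℂ), B.IsSimple ∧ Milne1999.IsOfCMType B ∧ B.dim = 12 ∧
        ∃ (P : AbelianVariety ℂ) (π : Fin 3 → (P ⟶ B)), Nonempty (IsLimit (Fan.mk P π)) ∧ ∃ g : A ⟶ P, IsIsogeny g := by
  obtain ⟨⟨hf, h1⟩, -, hN2, hN3⟩ := families_ninetyOne
  obtain ⟨hS, A, ι, θ, hA, hd⟩ := exists_isCMTypeRealisation_fermat (L := L) (M := 91) (by norm_num)
    (r := 1) (s := 9) (t := -1 - 9) (by decide) (by decide) (by decide) (by decide)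
  obtain ⟨B, hs, hcm, hdim, P, π, hP, g, hg⟩ := exists_isIsogeny_cube_simple_of_fermat_one_coprimeSix' hN2 hN3 hf h1 hA
  have htot : Nat.totient 91 = 72 := by decide
  exact ⟨hS, A, ι, θ, hA, by rw [hd, htot], B, hs, hcm, by omega, P, π, hP, g, hg⟩

/-- **Non-vacuity at `91`, second family** (`w = 27`): there IS a `36`-dimensional abelian variety of type
`(ℚ(ζ₉₁); Φ_{H_{1,27,63}})`, and every such variety is isogenous to `B × B` for a SIMPLE `18`-dimensional `B` of CM type.
[cite: KoblitzRohrlich1978, §1 (p. 1184) and Theorem 2 (p. 1186)] [cite: Shimura1998, §6.2 Thm. 3] -/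
theorem exists_realisation_isIsogeny_square_ninetyOne [IsCyclotomicExtension {91} ℚ L] :
    ∃ (hS : ∀ c : ZMod 91, c.val.Coprime 91 → (c ∈ fermatCMType 91 1 27 (-1 - 27) ↔ -c ∉ fermatCMType 91 1 27 (-1 - 27)))
      (A : AbelianVariety ℂ) (ι : 𝓞 L →+* End A) (θ : L →+* Module.End ℂ (complexBetti A.X 1)),
      IsCMTypeRealisation (cmTypeOfResidues (L := L) (fermatCMType 91 1 27 (-1 - 27)) hS) A ι θ ∧ A.dim = 36 ∧
      ∃ (B : AbelianVariety ℂ), B.IsSimple ∧ Milne1999.IsOfCMType B ∧ B.dim = 18 ∧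
        ∃ (P : AbelianVariety ℂ) (π : Fin 2 → (P ⟶ B)), Nonempty (IsLimit (Fan.mk P π)) ∧ ∃ g : A ⟶ P, IsIsogeny g := by
  obtain ⟨-, ⟨hsq, h1, h1'⟩, hN2, hN3⟩ := families_ninetyOne
  obtain ⟨hS, A, ι, θ, hA, hd⟩ := exists_isCMTypeRealisation_fermat (L := L) (M := 91) (by norm_num)
    (r := 1) (s := 27) (t := -1 - 27) (by decide) (by decide) (by decide) (by decide)
  obtain ⟨B, hs, hcm, hdim, P, π, hP, g, hg⟩ := exists_isIsogeny_square_simple_of_fermat_one_coprimeSix' hN2 hN3 hsq h1 h1' hA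
  have htot : Nat.totient 91 = 72 := by decide
  exact ⟨hS, A, ι, θ, hA, by rw [hd, htot], B, hs, hcm, by omega, P, π, hP, g, hg⟩

end Instances

end CyclotomicFermatCMType

end Literature.AlgebraicGeometry.ComplexMultiplication
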